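import Summits.Schanuel.Schanuel.Theorems.RootDecomp1BMovingZero08

/-!
# RootDecomp1BMovingZero — lens 4, generation 35/36 «AX-TRANSVERSAL MOVING ZERO»: T″ = `IsolatedIntersectionGeneral` PROVED modulo ONE print fact (`CurveSelection`) + the tree Ax statement, and SUB-PIECE A = `AnalyticMovingZero` PROVED modulo TWO print facts (`RoucheMaps`, `IsolatedZeroLowerBound`) — continuation (RootDecomp1BMovingZero09): §T (1/2) `CurveSelection` (THE ONE T-fact, by name) + non-vacuity, push-forward / identity-theorem plumbing, Taylor/Laurent bookkeeping

(lens-4 g35 HOME kernels MovingZeroTpp.lean 6bf08f88…de4e (2338 l = §G03 MovingZeroGeneral03 b461aa70… + §E MovingZeroExpPoly fdd5ca6b… + §X MovingZeroAxGerms a74f0949… verbatim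
bodies + NEW §T) and MovingZeroPieceA.lean 8899dedb…8da9 (238 l); ADDENDUM-2 L1857, writer re-check L1858, critic RULING L1859 (T″ VERIFIED and BOOKED; `CurveSelection`
ACCEPTED as THE ONE T-fact), RESULT/DONE L1865, critic RULING/ADDENDUM L1867 (A VERIFIED and BOOKED; `RoucheMaps` / `IsolatedZeroLowerBound` ACCEPTED AS TYPED),
lens-4 g36 NOTE/CLAIM L1871 (PORT-READY) and critic ACK L1875 (PORT STAGING GO; credits T (L1859) and A (L1867) paid at the critic's verification of the
accepted parts carrying `isolatedIntersectionGeneral_of_curveSelection` resp. `analyticMovingZero_of_facts`); port by census-1 gen 17 as `RootDecomp1BMovingZero03`–`10`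
PORT EDITS: the 44 `#guard_msgs in #print axioms` guards and their section headers dropped (HOME probes); `set_option linter.dupNamespace false` dropped; PieceA's
character-identical copy of `AnalyticMovingZero` dropped (§A's definition is used; its Facts + Proof sections follow §A in part 04); the four re-proved
`AxSchanuelTwoGerms` helpers (`exists_algDerivation_eq_derivative'`, `ofPowerSeries_taylor_exp_ne_zero'`, `algebraMap_eq_ofPowerSeries_C'`, `taylor_const'`) PRIVATE in
part 08 (statement-twins of the unbuilt Literature module) with a notation-free private copy `taylor_const''` in part 09; `CurveSelection`'s docstring replaced by the
FACT (T-ii) text dictated in L1871 (ACK L1875); the three fact docstrings' cite KEYS normalised to references.bib (`Chirka1989`, `DAngeloSCV1993` — the gate's cite-key lint), locators unchanged; nine one-line docstrings added; statements and proofs otherwise verbatim; `AxRankBoundLaurent` stays a binder BY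
NAME (discharge: HOME MovingZeroAxGermsTree.lean c3203867… once `AxSchanuelUniv` builds on the farm). `--supports stmt-Schanuel-32406`; no census credit carried;
rung 0 — nothing here proves Schanuel.)
-/

noncomputable section

namespace Summit.Schanuel.Schanuel.Theorems.RootDecomp1BMovingZero

/-- Taylor series of a constant — notation-free private copy of part 08's `taylor_const'` for this part (PORT EDIT: the HOME file's
single use in `laurent_taylor_const` is re-pointed here; the notation `𝓣[·]` is section-local below). [folklore] -/
private theorem taylor_const'' (c : ℂ) :
    (PowerSeries.mk fun n => ((Nat.factorial n : ℂ)⁻¹ * iteratedDeriv n (fun _ : ℂ => c) 0) : PowerSeries ℂ) =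
      PowerSeries.C c := by
  have h := Literature.Analysis.Complex.FormalRoot.taylor_polynomial (Polynomial.C c)
  simp only [Polynomial.eval_C] at h
  rw [h, Polynomial.coe_C]

/-! # §T — the T″ assembly (new) -/
/-! ## §T  helpers -/

section Tpp

open Complex Filter Topology

/-- **FACT (T-ii, accepted RULING L1859)** — curve selection at a non-isolated zero of a holomorphic map germ `ℂ² → ℂ²`:
if `Φ` is analytic at `p`, `Φ p = 0` and `p` is NOT an isolated zero, there is a non-constant analytic germ `γ : (ℂ, 0) → (ℂ², p)`
with `Φ ∘ γ = 0` near `0` (the zero set has dimension `≥ 1` at `p`, a 1-dimensional irreducible germ is the holomorphic image of a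
disc).  Strictly below Schanuel (complex-analytic geometry, no arithmetic); consumed BY NAME; non-vacuity `curveSelection_example`.
[cite: Chirka1989, §3.5 Prop. 1 p. 47 (dim₀ Z ≥ 1 ⟺ not isolated); §6.1 pp. 82–83 (an irreducible 1-dimensional germ is the
holomorphic image of a disc); §8.5 Prop. 1 p. 101] [cite: DAngeloSCV1993, p. 92; p. 69 (normalization); p. 67 Def. 7]
[corpus: book:chirkand-complex-analytic-sets p0047, p0082–0083, p0101; book:d-angelo2019-several-complex-variables-geometry-real-hypersurfaces
p0092, p0069, p0067] -/
def CurveSelection : Prop :=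
  ∀ (Φ : ℂ × ℂ → ℂ × ℂ) (p : ℂ × ℂ), AnalyticAt ℂ Φ p → Φ p = 0 → (∃ᶠ w in 𝓝[≠] p, Φ w = 0) →
    ∃ γ : ℂ → ℂ × ℂ, AnalyticAt ℂ γ 0 ∧ γ 0 = p ∧ (¬ ∀ᶠ s in 𝓝 0, γ s = p) ∧ ∀ᶠ s in 𝓝 0, Φ (γ s) = 0

/-- In `ℂ`, no point is eventually-everything: `¬ ∀ᶠ s in 𝓝 a, s = b`. -/
theorem not_eventually_eq_nhds (a b : ℂ) : ¬ ∀ᶠ s in 𝓝 a, s = b := by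
  intro h
  have h1 : ∀ᶠ s in 𝓝[≠] a, s = b := h.filter_mono nhdsWithin_le_nhds
  have h2 : ∀ᶠ s in 𝓝[≠] a, s ≠ a := self_mem_nhdsWithin
  by_cases hab : a = b
  · subst hab
    obtain ⟨s, hs1, hs2⟩ := (h1.and h2).exists
    exact hs2 hs1
  · have h3 : ∀ᶠ s in 𝓝 a, s ≠ b := (continuousAt_id).eventually_ne hab
    obtain ⟨s, hs1, hs2⟩ := (h1.and (h3.filter_mono nhdsWithin_le_nhds)).exists
    exact hs2 hs1

/-- Non-vacuity of `CurveSelection`: hypotheses AND conclusion hold for `Φ(w) = (w₂, w₂)` at `p = 0`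
(zero set = the line `{w₂ = 0}`, selected curve `s ↦ (s, 0)`). -/
theorem curveSelection_example :
    AnalyticAt ℂ (fun w : ℂ × ℂ => (w.2, w.2)) 0 ∧ (fun w : ℂ × ℂ => (w.2, w.2)) 0 = 0 ∧
      (∃ᶠ w in 𝓝[≠] (0 : ℂ × ℂ), (fun w : ℂ × ℂ => (w.2, w.2)) w = 0) ∧
      ∃ γ : ℂ → ℂ × ℂ, AnalyticAt ℂ γ 0 ∧ γ 0 = 0 ∧ (¬ ∀ᶠ s in 𝓝 0, γ s = 0) ∧
        ∀ᶠ s in 𝓝 0, (fun w : ℂ × ℂ => (w.2, w.2)) (γ s) = 0 := by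
  refine ⟨analyticAt_snd.prod analyticAt_snd, by simp, ?_, ⟨fun s => (s, 0), ?_, by simp, ?_, ?_⟩⟩
  · by_contra H
    rw [Filter.not_frequently, eventually_nhdsWithin_iff] at H
    have ht : Tendsto (fun s : ℂ => ((s, 0) : ℂ × ℂ)) (𝓝 0) (𝓝 ((0 : ℂ), (0 : ℂ))) :=
      ((continuous_id.prodMk continuous_const).tendsto (0 : ℂ) : _)
    have h2 := ht.eventually H
    apply not_eventually_eq_nhds (0 : ℂ) 0
    filter_upwards [h2] with s hs
    by_contra hs0
    exact hs (by simpa using hs0) (by simp)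
  · exact analyticAt_id.prod analyticAt_const
  · intro h
    apply not_eventually_eq_nhds (0 : ℂ) 0
    filter_upwards [h] with s hs
    simpa using hs
  · simp

/-- Push-forward of an eventual property along a non-eventually-constant map: if `P (x s)` holds for `s` near `0`,
`x s → x₀` and `x` is not eventually `x₀`, then `P` holds frequently on the punctured neighbourhood of `x₀`. -/
theorem frequently_nhdsNE_of_eventually_comp {x : ℂ → ℂ} {x₀ : ℂ} (hx : Tendsto x (𝓝 0) (𝓝 x₀))
    (hne : ¬ ∀ᶠ s in 𝓝 0, x s = x₀) {P : ℂ → Prop} (hP : ∀ᶠ s in 𝓝 0, P (x s)) :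
    ∃ᶠ u in 𝓝[≠] x₀, P u := by
  by_contra H
  rw [Filter.not_frequently, eventually_nhdsWithin_iff] at H
  apply hne
  filter_upwards [hx.eventually H, hP] with s hs hPs
  by_contra hsx
  exact hs hsx hPs

/-- Specialising `t ↦ ρ` in an integer coefficient polynomial `G(t, X, Y)`: the `ℂ`-polynomial in `(X, Y)`. -/
def specT (ρ : ℂ) (G : MvPolynomial (Fin 3) ℤ) : MvPolynomial (Fin 2) ℂ :=
  MvPolynomial.aeval ![MvPolynomial.C ρ, MvPolynomial.X 0, MvPolynomial.X 1] G

/-- Evaluation of the `ρ`-specialisation `specT ρ G` at `(a, b)` is `G(ρ, a, b)`. -/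
theorem eval_specT (ρ a b : ℂ) (G : MvPolynomial (Fin 3) ℤ) :
    MvPolynomial.eval ![a, b] (specT ρ G) = MvPolynomial.aeval ![ρ, a, b] G := by
  induction G using MvPolynomial.induction_on with
  | C n => simp [specT]
  | add p q hp hq => simp only [specT, map_add] at *; rw [hp, hq]
  | mul_X p i ih =>
    simp only [specT, map_mul] at *
    rw [ih]
    congr 1
    fin_cases i <;> simp

/-- Specialising `t ↦ ρ`, `X ↦ X₀`: the `ℂ`-polynomial in `Y`. -/
def specTX (ρ X₀ : ℂ) (G : MvPolynomial (Fin 3) ℤ) : Polynomial ℂ :=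
  MvPolynomial.aeval ![Polynomial.C ρ, Polynomial.C X₀, Polynomial.X] G

/-- Evaluation of the `(ρ, X₀)`-specialisation `specTX ρ X₀ G` at `b` is `G(ρ, X₀, b)`. -/
theorem eval_specTX (ρ X₀ b : ℂ) (G : MvPolynomial (Fin 3) ℤ) :
    (specTX ρ X₀ G).eval b = MvPolynomial.aeval ![ρ, X₀, b] G := by
  induction G using MvPolynomial.induction_on with
  | C n => simp [specTX]
  | add p q hp hq => simp only [specTX, map_add, Polynomial.eval_add] at *; rw [hp, hq]
  | mul_X p i ih =>
    simp only [specTX, map_mul, Polynomial.eval_mul] at *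
    rw [ih]
    congr 1
    fin_cases i <;> simp

/-- `¬ IsolatedAt'` in filter language: the common zeros of `Φ_ρ` accumulate at `θ′`. -/
theorem frequently_zero_of_not_isolatedAt' {ρ : ℝ} {X₀ Y₀ : ℂ} {K₁ K₂ : ℕ}
    {G₁ : Fin (K₁ + 1) → MvPolynomial (Fin 3) ℤ} {G₂ : Fin (K₂ + 1) → MvPolynomial (Fin 3) ℤ}
    (h : ¬ IsolatedAt' ρ X₀ Y₀ G₁ G₂) : ∃ᶠ w in 𝓝[≠] ((X₀, Y₀) : ℂ × ℂ), curveΦ G₁ G₂ ρ w = 0 := by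
  unfold IsolatedAt' at h
  push Not at h
  rw [(Metric.nhdsWithin_basis_ball).frequently_iff]
  intro ε hε
  obtain ⟨X, Y, h1, h2, hr1, hr2, hne⟩ := h ε hε
  refine ⟨(X, Y), ⟨?_, ?_⟩, ?_⟩
  · rw [Metric.mem_ball, Prod.dist_eq, dist_eq_norm, dist_eq_norm]
    exact max_lt h1 h2
  · intro hXY
    simp only [Set.mem_singleton_iff, Prod.mk.injEq] at hXY
    exact hne hXY.1 hXY.2
  · simp only [curveΦ, Prod.mk_eq_zero]
    exact ⟨hr1, hr2⟩

/-- An accumulation point of zeros of a map continuous there is a zero. -/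
theorem eq_zero_of_frequently {Φ : ℂ × ℂ → ℂ × ℂ} {p : ℂ × ℂ} (hΦ : ContinuousAt Φ p)
    (hfreq : ∃ᶠ w in 𝓝[≠] p, Φ w = 0) : Φ p = 0 := by
  by_contra hne
  obtain ⟨w, hw1, hw2⟩ :=
    (hfreq.and_eventually (eventually_nhdsWithin_of_eventually_nhds (hΦ.eventually_ne hne))).exists
  exact hw2 hw1

end Tpp

section Taylor

open Complex Filter Topology
open Literature.NumberTheory.Transcendental.AndreCriterion (coeff_taylor constantCoeff_taylor taylor_congr taylor_add
  taylor_sum taylor_const_mul taylor_mul taylor_one taylor_pow)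
open Literature.Analysis.Complex.FormalRoot (taylor_eq_zero_iff eventuallyEq_of_taylor_eq)

local notation3 "𝓣[" f "]" =>
  (PowerSeries.mk fun n => ((Nat.factorial n : ℂ)⁻¹ * iteratedDeriv n f 0) : PowerSeries ℂ)

local notation3 "𝓛[" f "]" => (HahnSeries.ofPowerSeries ℤ ℂ 𝓣[f] : LaurentSeries ℂ)

/-- `𝓛[const c] = algebraMap ℂ ℂ⸨X⸩ c`. -/
theorem laurent_taylor_const (c : ℂ) : 𝓛[fun _ : ℂ => c] = algebraMap ℂ (LaurentSeries ℂ) c := by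
  rw [taylor_const'']; rfl

/-- Analytic vectors `u ↦ (f u, g u, h u)` componentwise. -/
theorem analyticAt_vec3_of {f g h : ℂ → ℂ} {u : ℂ} (hf : AnalyticAt ℂ f u) (hg : AnalyticAt ℂ g u)
    (hh : AnalyticAt ℂ h u) (i : Fin 3) : AnalyticAt ℂ (fun u => (![f u, g u, h u] : Fin 3 → ℂ) i) u := by
  refine Fin.cases ?_ (fun j => ?_) i
  · simpa using hf
  · refine Fin.cases ?_ (fun k => ?_) j
    · simpa using hg
    · refine Fin.cases ?_ (fun l => l.elim0) k
      simpa using hh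

/-- Analytic vectors `u ↦ (f u, g u)` componentwise. -/
theorem analyticAt_vec2_of {f g : ℂ → ℂ} {u : ℂ} (hf : AnalyticAt ℂ f u) (hg : AnalyticAt ℂ g u) (i : Fin 2) :
    AnalyticAt ℂ (fun u => (![f u, g u] : Fin 2 → ℂ) i) u := by
  refine Fin.cases ?_ (fun j => ?_) i
  · simpa using hf
  · refine Fin.cases ?_ (fun l => l.elim0) j
    simpa using hg

/-- The Taylor series of `s ↦ G(ρ, X(s), Y(s))` (integer polynomial `G`, analytic `X, Y`) is analytic data lying
in any subalgebra of `ℂ⸨X⸩` containing `𝓛[X], 𝓛[Y]`. -/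
theorem analyticAt_and_taylor_aeval_mem {X Y : ℂ → ℂ} (hX : AnalyticAt ℂ X 0) (hY : AnalyticAt ℂ Y 0) (ρ : ℂ)
    (A : Subalgebra ℂ (LaurentSeries ℂ)) (hXA : 𝓛[X] ∈ A) (hYA : 𝓛[Y] ∈ A) (G : MvPolynomial (Fin 3) ℤ) :
    AnalyticAt ℂ (fun s => MvPolynomial.aeval ![ρ, X s, Y s] G) 0 ∧
      𝓛[fun s => MvPolynomial.aeval ![ρ, X s, Y s] G] ∈ A := by
  induction G using MvPolynomial.induction_on with
  | C n =>
    have hfun : (fun s => MvPolynomial.aeval ![ρ, X s, Y s] (MvPolynomial.C n)) = fun _ => (n : ℂ) := by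
      funext s; rw [MvPolynomial.aeval_C, eq_intCast]
    rw [hfun]
    exact ⟨analyticAt_const, by rw [laurent_taylor_const]; exact A.algebraMap_mem _⟩
  | add p q hp hq =>
    simp only [map_add]
    refine ⟨hp.1.add hq.1, ?_⟩
    have h := taylor_add hp.1 hq.1
    rw [show ((fun s => MvPolynomial.aeval ![ρ, X s, Y s] p) + fun s => MvPolynomial.aeval ![ρ, X s, Y s] q) =
      fun s => MvPolynomial.aeval ![ρ, X s, Y s] p + MvPolynomial.aeval ![ρ, X s, Y s] q from rfl] at h
    rw [h, map_add]
    exact A.add_mem hp.2 hq.2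
  | mul_X p i ih =>
    simp only [map_mul, MvPolynomial.aeval_X]
    have hv : AnalyticAt ℂ (fun s => (![ρ, X s, Y s] : Fin 3 → ℂ) i) 0 ∧ 𝓛[fun s => (![ρ, X s, Y s] : Fin 3 → ℂ) i] ∈ A := by
      refine Fin.cases ?_ (fun j => ?_) i
      · simp only [Matrix.cons_val_zero]
        exact ⟨analyticAt_const, by rw [laurent_taylor_const]; exact A.algebraMap_mem _⟩
      · refine Fin.cases ?_ (fun k => ?_) j
        · simp only [Matrix.cons_val_succ, Matrix.cons_val_zero]; exact ⟨hX, hXA⟩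
        · refine Fin.cases ?_ (fun l => l.elim0) k
          simp only [Matrix.cons_val_succ, Matrix.cons_val_zero]; exact ⟨hY, hYA⟩
    refine ⟨ih.1.mul hv.1, ?_⟩
    have h := taylor_mul ih.1 hv.1
    rw [show ((fun s => MvPolynomial.aeval ![ρ, X s, Y s] p) * fun s => (![ρ, X s, Y s] : Fin 3 → ℂ) i) =
      fun s => MvPolynomial.aeval ![ρ, X s, Y s] p * (![ρ, X s, Y s] : Fin 3 → ℂ) i from rfl] at h
    rw [h, map_mul]
    exact A.mul_mem ih.2 hv.2

/-- **Algebraicity from an analytic relation.**  If `Σ_k c_k(s) E(s)^k = 0` near `0` with analytic `c_k, E`, the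
`𝓛[c_k]` in a subalgebra `A ⊆ ℂ⸨X⸩` and `c_K(0) ≠ 0`, then `𝓛[E]` is algebraic over `A`. -/
theorem isAlgebraic_taylor_of_relation {K : ℕ} (A : Subalgebra ℂ (LaurentSeries ℂ)) {c : Fin (K + 1) → ℂ → ℂ}
    {E : ℂ → ℂ} (hc : ∀ k, AnalyticAt ℂ (c k) 0) (hE : AnalyticAt ℂ E 0) (hmem : ∀ k, 𝓛[c k] ∈ A)
    (htop : c (Fin.last K) 0 ≠ 0) (hrel : ∀ᶠ s in 𝓝 0, ∑ k : Fin (K + 1), c k s * E s ^ (k : ℕ) = 0) :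
    IsAlgebraic A 𝓛[E] := by
  classical
  set P : Polynomial A := ∑ k : Fin (K + 1), Polynomial.monomial (k : ℕ) (⟨𝓛[c k], hmem k⟩ : A) with hP
  refine ⟨P, ?_, ?_⟩
  · intro h0
    have hcoeff : P.coeff K = (⟨𝓛[c (Fin.last K)], hmem (Fin.last K)⟩ : A) := by
      rw [hP, Polynomial.finsetSum_coeff, Finset.sum_eq_single (Fin.last K)]
      · simp
      · intro k _ hk
        rw [Polynomial.coeff_monomial, if_neg (fun hkK => hk (Fin.ext (hkK.trans (Fin.val_last K).symm)))]
      · intro h; exact absurd (Finset.mem_univ _) h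
    rw [h0, Polynomial.coeff_zero] at hcoeff
    have hval : 𝓛[c (Fin.last K)] = 0 := by
      have := congrArg Subtype.val hcoeff
      simpa using this.symm
    have hT : 𝓣[c (Fin.last K)] = 0 :=
      HahnSeries.ofPowerSeries_injective (by rw [hval, map_zero])
    have h1 := constantCoeff_taylor (c (Fin.last K))
    rw [hT, map_zero] at h1
    exact htop h1.symm
  · have h1 : Polynomial.aeval 𝓛[E] P = ∑ k : Fin (K + 1), 𝓛[c k] * 𝓛[E] ^ (k : ℕ) := by
      rw [hP, map_sum]
      refine Finset.sum_congr rfl (fun k _ => ?_)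
      rw [Polynomial.aeval_monomial]
      rfl
    have hterm : ∀ k : Fin (K + 1), AnalyticAt ℂ (c k * E ^ (k : ℕ)) 0 := fun k => (hc k).mul (hE.pow k)
    have h2 : ∑ k : Fin (K + 1), 𝓛[c k] * 𝓛[E] ^ (k : ℕ) = 𝓛[∑ k : Fin (K + 1), c k * E ^ (k : ℕ)] := by
      rw [taylor_sum Finset.univ (fun k _ => hterm k), map_sum]
      refine Finset.sum_congr rfl (fun k _ => ?_)
      rw [taylor_mul (hc k) (hE.pow k), taylor_pow hE, map_mul, map_pow]
    have h3 : 𝓣[∑ k : Fin (K + 1), c k * E ^ (k : ℕ)] = 0 := by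
      rw [taylor_eq_zero_iff (Finset.analyticAt_sum Finset.univ (fun k _ => hterm k))]
      filter_upwards [hrel] with s hs
      simpa [Finset.sum_apply] using hs
    rw [h1, h2, h3, map_zero]

end Taylor

end Summit.Schanuel.Schanuel.Theorems.RootDecomp1BMovingZero

end
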